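import Mathlib.Analysis.SpecialFunctions.Arsinh
import Literature.Analysis.Complex.PeriodicStripFourierTorus
import Summits.HubbardSuperconductivity.HubbardSuperconductivity.Theorems.KLProgrammeKLRegimeScaleZeroCovarianceTorusPeriodisation

/-!
# Route `KLProgramme`, crux K3 — engine-flow child (stmt-HubbardSuperconductivity-20437), stub (C) at `n = 0`, located item #22a «(C)-SCALE0-PT2»,
# (2e) FAR SITES: EXPONENTIAL off-site decay of the scale-`0` covariance's spatial kernel on the CUTOFF-FREE SHELL `|ω| ≥ Λ`, per frequency

On the shell `|ω| ≥ Λ` the UV weight `χ₂((ω²+e²)/Λ²)` is identically `1`, so the spatial symbol of one frequency is the bare resolvent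
`g_ω(y) = (e_0(2πy) − iω)⁻¹`, `e_0(q) = −2(cos q₀ + cos q₁) − μ` (§A).  Its sections in each coordinate extend holomorphically to the strip
`|Im z| < arsinh(|ω|/4)/(2π)`, where `2|Im cos(2πz)| < |ω|/2` keeps the denominator's imaginary part above `|ω|/2` (§B: `‖D⁻¹‖ ≤ 2/|ω|`,
`1`-periodic, measurable descent, real points).  The coordinatewise analyticity-strip estimate on `𝕋²`
(`Literature/Analysis/Complex/PeriodicStripFourierTorus.norm_mFourierCoeff_le_exp_of_strip_sup`) then gives THE DOOR (§C):

  **`‖𝓕g_ω(n)‖ ≤ (2/|ω|)·exp(−arsinh(|ω|/4)·‖n‖∞)`**  (`norm_mFourierCoeff_uvSpatialSymbol_le_exp`),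

i.e. `e^{−‖n‖∞/128.0…}` at `|ω| = Λ = klE0 = 1/32` and `e^{−0.247‖n‖∞}` at `|ω| = 1` — in place of the power law `(1+‖n‖∞)^{−N}` with the
`N!·ℓ_J^N`-sized constants of the momentum-jet route (`…ScaleZeroCovarianceTorusPeriodisation` §3/§4), which cannot book the far ring at any
near-disk radius below `≈ 1.7·10⁴` (HOME/p1/g21/FAR-JETS-FLOOR-p1g21.md).  The finite-`L` sample follows by the images identity
`torusFourierInv_uvSpatialSample_eq_tsum_images` and `PeriodizedDecay.sub_le_norm_translate` (not done here).  The complementary LOW shell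
`|ω| < Λ`, where `χ₂` is active and only Gevrey-2, is NOT covered by this file.
[cite: TrefethenWeideman2014, §4 Thm. 4.2]; [cite: BenfattoGiulianiMastropietro2006, §2.2 (2.9), §3 (3.2)]; [cite: GlimmJaffeQP1987, Prop. 7.3.1].
-/

noncomputable section

namespace Summit.HubbardSuperconductivity.HubbardSuperconductivity.Theorems.KLRegimeSplit

set_option linter.dupNamespace false -- summit = problem name (single-conjunct summit), D-0017

open Literature.MathematicalPhysics.QuantumLattice Literature.Analysis.FunctionSpaces
open Summit.HubbardSuperconductivity.HubbardSuperconductivity.Theorems.DispersionFlow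
open Complex UnitAddTorus Real

/-! ## §A The cutoff-free shell `|ω| ≥ Λ`: the scale-0 symbol IS the bare resolvent -/

/-- **Cutoff-free shell**: for `0 < Λ ≤ |ω|` the UV weight is `χ₂((ω²+e²)/Λ²) = 1` for EVERY level `e`, so
`Ψ(1, Λ; e, ω) = (−iω + e)⁻¹` exactly (`salmhoferCutoff_of_ge`). -/
theorem uvSymbolFn_one_eq_inv_of_le {Λ om : ℝ} (hΛ : 0 < Λ) (hom : Λ ≤ |om|) (e : ℝ) :
    uvSymbolFn 1 Λ e om = (-I * om + e)⁻¹ := by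
  have h1 : (1 : ℝ) ≤ (om ^ 2 + e ^ 2) / Λ ^ 2 := by
    rw [le_div_iff₀ (by positivity), one_mul]
    have h2 : Λ ^ 2 ≤ |om| ^ 2 := pow_le_pow_left₀ hΛ.le hom 2
    rw [sq_abs] at h2
    nlinarith [sq_nonneg e]
  simp only [uvSymbolFn, uvWeightFn, resolventFn, salmhoferCutoff_of_ge h1, add_zero, Complex.ofReal_one, one_mul, one_div]

/-! ## §B The complex sections of the bare resolvent symbol: strip, bound, periodicity -/

/-- `|Im cos z| ≤ sinh|Im z|` (from `cos z = cos x cosh y − i sin x sinh y`). [folklore] -/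
theorem abs_im_cos_le_sinh_abs_im (z : ℂ) : |(Complex.cos z).im| ≤ Real.sinh |z.im| := by
  rw [Complex.cos_eq z]
  have h : (Complex.cos z.re * Complex.cosh z.im - Complex.sin z.re * Complex.sinh z.im * I).im =
      -(Real.sin z.re * Real.sinh z.im) := by
    simp [Complex.mul_im, Complex.sub_im, Complex.mul_re, Complex.cos_ofReal_im, Complex.sin_ofReal_im, Complex.cosh_ofReal_im,
      Complex.sinh_ofReal_im, Complex.sin_ofReal_re, Complex.sinh_ofReal_re, Complex.I_im, Complex.I_re]
  rw [h, abs_neg, abs_mul, ← Real.abs_sinh]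
  calc |Real.sin z.re| * |Real.sinh z.im| ≤ 1 * |Real.sinh z.im| :=
        mul_le_mul_of_nonneg_right (Real.abs_sin_le_one _) (abs_nonneg _)
    _ = |Real.sinh z.im| := one_mul _

/-- **The strip**: on `|Im z| < arsinh(|ω|/4)/(2π)` one has `2·|Im cos(2πz)| < |ω|/2`, hence the denominator
`D(z) = −iω − 2(cos 2πz + cos 2πt) − μ` has `|Im D| > |ω|/2`; in particular `D ≠ 0` and `‖D⁻¹‖ ≤ 2/|ω|`. [folklore] -/
theorem norm_inv_bareDen_le {om : ℝ} (hom : om ≠ 0) (μ t : ℝ) {z : ℂ} (hz : |z.im| < Real.arsinh (|om| / 4) / (2 * π)) :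
    (-I * om + (-2 * (Complex.cos (2 * π * z) + (Real.cos (2 * π * t) : ℂ)) - μ)) ≠ 0 ∧
      ‖(-I * om + (-2 * (Complex.cos (2 * π * z) + (Real.cos (2 * π * t) : ℂ)) - μ))⁻¹‖ ≤ 2 / |om| := by
  have hom0 : 0 < |om| := abs_pos.2 hom
  have h2π : (0 : ℝ) < 2 * π := Real.two_pi_pos
  -- the imaginary part of `cos(2πz)` is small on the strip
  have him : |(Complex.cos (2 * π * z)).im| < |om| / 4 := by
    refine (abs_im_cos_le_sinh_abs_im _).trans_lt ?_
    have h0 : (2 * π * z : ℂ).im = 2 * π * z.im := by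
      simp [Complex.mul_im, Complex.mul_re]
    have h1 : |(2 * π * z : ℂ).im| = 2 * π * |z.im| := by
      rw [h0, abs_mul, abs_of_pos h2π]
    rw [h1, ← Real.sinh_arsinh (|om| / 4), Real.sinh_lt_sinh]
    rwa [lt_div_iff₀ h2π, mul_comm] at hz
  set D : ℂ := -I * om + (-2 * (Complex.cos (2 * π * z) + (Real.cos (2 * π * t) : ℂ)) - μ) with hD
  have hDim : D.im = -om - 2 * (Complex.cos (2 * π * z)).im := by
    simp only [hD, Complex.add_im, Complex.sub_im, Complex.mul_im, Complex.neg_re, Complex.neg_im, Complex.I_re, Complex.I_im,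
      Complex.ofReal_re, Complex.ofReal_im, Complex.re_ofNat, Complex.im_ofNat]
    ring
  have hDim' : |om| / 2 < |D.im| := by
    rw [hDim]
    have := abs_sub_abs_le_abs_sub (-om) (2 * (Complex.cos (2 * π * z)).im)
    rw [abs_neg, abs_mul, abs_two] at this
    have h3 : |(-om) - 2 * (Complex.cos (2 * π * z)).im| = |-om - 2 * (Complex.cos (2 * π * z)).im| := rfl
    linarith [him]
  have hDnorm : |om| / 2 < ‖D‖ := hDim'.trans_le (Complex.abs_im_le_norm D)
  have hD0 : D ≠ 0 := fun h => by rw [h, norm_zero] at hDnorm; linarith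
  refine ⟨hD0, ?_⟩
  rw [norm_inv, inv_le_comm₀ (norm_pos_iff.2 hD0) (by positivity), inv_div]
  exact hDnorm.le

/-- **Holomorphy on the strip** of `z ↦ D(z)⁻¹`. [folklore] -/
theorem differentiableOn_inv_bareDen {om : ℝ} (hom : om ≠ 0) (μ t : ℝ) :
    DifferentiableOn ℂ (fun z : ℂ => (-I * om + (-2 * (Complex.cos (2 * π * z) + (Real.cos (2 * π * t) : ℂ)) - μ))⁻¹)
      {z : ℂ | |z.im| < Real.arsinh (|om| / 4) / (2 * π)} := by
  have hD : Differentiable ℂ (fun z : ℂ => -I * om + (-2 * (Complex.cos (2 * π * z) + (Real.cos (2 * π * t) : ℂ)) - μ)) := by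
    fun_prop
  intro z hz
  exact ((hD z).inv (norm_inv_bareDen_le hom μ t hz).1).differentiableWithinAt

/-- **`1`-periodicity** of `z ↦ D(z)⁻¹`. [folklore] -/
theorem inv_bareDen_periodic (om μ t : ℝ) (z : ℂ) :
    (-I * om + (-2 * (Complex.cos (2 * π * (z + 1)) + (Real.cos (2 * π * t) : ℂ)) - μ))⁻¹ =
      (-I * om + (-2 * (Complex.cos (2 * π * z) + (Real.cos (2 * π * t) : ℂ)) - μ))⁻¹ := by
  rw [show (2 : ℂ) * π * (z + 1) = 2 * π * z + 2 * π by ring, Complex.cos_add_two_pi]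

/-- Representatives: `cos(2π·repr(x)) = cos(2πx)` for the `[0,1)`-representative of a real point of the circle. [folklore] -/
theorem cos_two_pi_mul_equivIco (x : ℝ) :
    Real.cos (2 * π * ((AddCircle.equivIco (1 : ℝ) 0 (x : UnitAddCircle) : ℝ))) = Real.cos (2 * π * x) := by
  set r : ℝ := ((AddCircle.equivIco (1 : ℝ) 0 (x : UnitAddCircle) : ℝ)) with hr
  have h1 : ((r : ℝ) : AddCircle (1 : ℝ)) = (x : AddCircle (1 : ℝ)) := by
    rw [hr]
    exact AddCircle.coe_equivIco
  have h2 : (((r - x : ℝ)) : AddCircle (1 : ℝ)) = 0 := by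
    rw [AddCircle.coe_sub, h1, sub_self]
  obtain ⟨n, hn⟩ := (AddCircle.coe_eq_zero_iff (p := (1 : ℝ))).1 h2
  have h3 : r = x + n := by
    rw [zsmul_eq_mul, mul_one] at hn
    linarith
  rw [h3, mul_add, show 2 * π * (n : ℝ) = n * (2 * π) by ring, Real.cos_add_int_mul_two_pi]

/-- **Real points**: the descent of the cutoff-free spatial symbol, evaluated at the torus point `(s, t)`, is `D_t(s)⁻¹`
(`0 < Λ ≤ |ω|`). -/
theorem descend_uvSpatialSymbol_apply_eq_inv {Λ om : ℝ} (hΛ : 0 < Λ) (hom : Λ ≤ |om|) (μ s t : ℝ) :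
    Torus.descend (fun y : Momentum => uvSymbolFn 1 Λ (frameLevel μ 0 ((2 * π) • y)) om)
        (uvSpatialSymbol_isLatticePeriodic 1 Λ μ 0 om) (fun i => (((![s, t] : Fin 2 → ℝ) i : ℝ) : UnitAddCircle)) =
      (-I * om + (-2 * (Complex.cos (2 * π * s) + (Real.cos (2 * π * t) : ℂ)) - μ))⁻¹ := by
  rw [Torus.descend_apply, uvSymbolFn_one_eq_inv_of_le hΛ hom]
  congr 2
  simp only [frameLevel, squareDispersion, TrigPolyC4v.eval_zero, sub_zero, mul_one, mul_zero, zero_mul,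
    PiLp.smul_apply, smul_eq_mul, Torus.repr_apply, Matrix.cons_val_zero, Matrix.cons_val_one]
  rw [cos_two_pi_mul_equivIco s, cos_two_pi_mul_equivIco t]
  push_cast
  ring

/-- **Measurability** of the descended spatial symbol (`ω ≠ 0`). -/
theorem measurable_descend_uvSpatialSymbol (Λ μ : ℝ) {om : ℝ} (hom : om ≠ 0) :
    Measurable (Torus.descend (fun y : Momentum => uvSymbolFn 1 Λ (frameLevel μ 0 ((2 * π) • y)) om)
      (uvSpatialSymbol_isLatticePeriodic 1 Λ μ 0 om)) :=
  (uvSpatialSymbol_contDiff 1 μ 0 hom).continuous.measurable.comp Torus.measurable_repr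

/-! ## §C THE DOOR: exponential decay of the infinite-lattice kernel of the cutoff-free shell, per frequency -/

/-- **Exponential off-site decay of the scale-`0` covariance's spatial kernel on the cutoff-free shell** (`0 < Λ ≤ |ω|`): the Fourier
coefficients of `y ↦ Ψ(1, Λ; e_0(2πy), ω) = (e_0(2πy) − iω)⁻¹` obey
`‖𝓕g_ω(n)‖ ≤ (2/|ω|)·exp(−arsinh(|ω|/4)·max(|n₀|, |n₁|))` — contour shift by `arsinh(|ω|/4)/(2π)` in the coordinate carrying `‖n‖∞`
(`Literature/Analysis/Complex/PeriodicStripFourierTorus`); e.g. `e^{−‖n‖∞/128.0…}` at `|ω| = Λ = klE0 = 1/32`, `e^{−0.247‖n‖∞}` at `|ω| = 1`.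
This replaces the power law of the momentum-jet route (`…TorusPeriodisation`, constants `n!·ℓ_Jⁿ`) on the shell `|ω| ≥ Λ`.
[cite: TrefethenWeideman2014, §4 Thm. 4.2]; [cite: BenfattoGiulianiMastropietro2006, §2.2 (2.9)] -/
theorem norm_mFourierCoeff_uvSpatialSymbol_le_exp {Λ : ℝ} (hΛ : 0 < Λ) (μ : ℝ) {om : ℝ} (hom : Λ ≤ |om|) (n : Fin 2 → ℤ) :
    ‖mFourierCoeff (Torus.descend (fun y : Momentum => uvSymbolFn 1 Λ (frameLevel μ 0 ((2 * π) • y)) om)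
        (uvSpatialSymbol_isLatticePeriodic 1 Λ μ 0 om)) n‖ ≤
      2 / |om| * Real.exp (-(Real.arsinh (|om| / 4) * max |(n 0 : ℝ)| |(n 1 : ℝ)|)) := by
  have hom0' : 0 < |om| := hΛ.trans_le hom
  have hom0 : om ≠ 0 := abs_pos.1 hom0'
  have h2π : (0 : ℝ) < 2 * π := Real.two_pi_pos
  set a : ℝ := Real.arsinh (|om| / 4) / (2 * π) with ha_def
  have ha : 0 < a := div_pos (Real.arsinh_pos_iff.2 (by positivity)) h2π
  set v : ℝ → ℂ → ℂ := fun t z => (-I * om + (-2 * (Complex.cos (2 * π * z) + (Real.cos (2 * π * t) : ℂ)) - μ))⁻¹ with hv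
  have hd : ∀ t, DifferentiableOn ℂ (v t) {z : ℂ | |z.im| < a} := fun t => differentiableOn_inv_bareDen hom0 μ t
  have hper : ∀ t (z : ℂ), v t (z + 1) = v t z := fun t z => inv_bareDen_periodic om μ t z
  have hM : ∀ t (z : ℂ), |z.im| < a → ‖v t z‖ ≤ 2 / |om| := fun t z hz => (norm_inv_bareDen_le hom0 μ t hz).2
  have hv₀ : ∀ t s : ℝ, v t s = Torus.descend (fun y : Momentum => uvSymbolFn 1 Λ (frameLevel μ 0 ((2 * π) • y)) om)
      (uvSpatialSymbol_isLatticePeriodic 1 Λ μ 0 om) (fun i => (((![s, t] : Fin 2 → ℝ) i : ℝ) : UnitAddCircle)) :=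
    fun t s => (descend_uvSpatialSymbol_apply_eq_inv hΛ hom μ s t).symm
  have hv₁ : ∀ s t : ℝ, v s t = Torus.descend (fun y : Momentum => uvSymbolFn 1 Λ (frameLevel μ 0 ((2 * π) • y)) om)
      (uvSpatialSymbol_isLatticePeriodic 1 Λ μ 0 om) (fun i => (((![s, t] : Fin 2 → ℝ) i : ℝ) : UnitAddCircle)) := by
    intro s t
    rw [descend_uvSpatialSymbol_apply_eq_inv hΛ hom μ s t, hv]
    simp only
    rw [add_comm (Complex.cos (2 * π * (t : ℂ))), Complex.ofReal_cos, Complex.ofReal_cos]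
    push_cast
    ring
  have key := Literature.Analysis.Complex.norm_mFourierCoeff_le_exp_of_strip_sup (measurable_descend_uvSpatialSymbol Λ μ hom0)
    ha v v hd hper hM hv₀ hd hper hM hv₁ n
  have h2 : 2 * π * a = Real.arsinh (|om| / 4) := by
    rw [ha_def]; field_simp
  rw [h2] at key
  exact key

/-! ## §D (append) The θ-sharpened strip: rate `arsinh(θ|ω|/2)`, height `1/((1−θ)|ω|)`, `0 < θ < 1` -/

/-- **θ-strip**: on `|Im z| < arsinh(θ|ω|/2)/(2π)` (`0 < θ < 1`) the denominator has `|Im D| > (1−θ)|ω|`, so `D ≠ 0` and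
`‖D⁻¹‖ ≤ 1/((1−θ)|ω|)` (§B is `θ = 1/2`). [folklore] -/
theorem norm_inv_bareDen_le_of_lt_one {om : ℝ} (hom : om ≠ 0) {θ : ℝ} (hθ1 : θ < 1) (μ t : ℝ) {z : ℂ}
    (hz : |z.im| < Real.arsinh (θ * |om| / 2) / (2 * π)) :
    (-I * om + (-2 * (Complex.cos (2 * π * z) + (Real.cos (2 * π * t) : ℂ)) - μ)) ≠ 0 ∧
      ‖(-I * om + (-2 * (Complex.cos (2 * π * z) + (Real.cos (2 * π * t) : ℂ)) - μ))⁻¹‖ ≤ 1 / ((1 - θ) * |om|) := by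
  have hom0 : 0 < |om| := abs_pos.2 hom
  have h2π : (0 : ℝ) < 2 * π := Real.two_pi_pos
  have h1θ : 0 < 1 - θ := by linarith
  have him : |(Complex.cos (2 * π * z)).im| < θ * |om| / 2 := by
    refine (abs_im_cos_le_sinh_abs_im _).trans_lt ?_
    have h0 : (2 * π * z : ℂ).im = 2 * π * z.im := by
      simp [Complex.mul_im, Complex.mul_re]
    have h1 : |(2 * π * z : ℂ).im| = 2 * π * |z.im| := by
      rw [h0, abs_mul, abs_of_pos h2π]
    rw [h1, ← Real.sinh_arsinh (θ * |om| / 2), Real.sinh_lt_sinh]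
    rwa [lt_div_iff₀ h2π, mul_comm] at hz
  set D : ℂ := -I * om + (-2 * (Complex.cos (2 * π * z) + (Real.cos (2 * π * t) : ℂ)) - μ) with hD
  have hDim : D.im = -om - 2 * (Complex.cos (2 * π * z)).im := by
    simp only [hD, Complex.add_im, Complex.sub_im, Complex.mul_im, Complex.neg_re, Complex.neg_im, Complex.I_re, Complex.I_im,
      Complex.ofReal_re, Complex.ofReal_im, Complex.re_ofNat, Complex.im_ofNat]
    ring
  have hDim' : (1 - θ) * |om| < |D.im| := by
    rw [hDim]
    have := abs_sub_abs_le_abs_sub (-om) (2 * (Complex.cos (2 * π * z)).im)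
    rw [abs_neg, abs_mul, abs_two] at this
    nlinarith [him]
  have hDnorm : (1 - θ) * |om| < ‖D‖ := hDim'.trans_le (Complex.abs_im_le_norm D)
  have hD0 : D ≠ 0 := fun h => by rw [h, norm_zero] at hDnorm; nlinarith
  refine ⟨hD0, ?_⟩
  rw [norm_inv, one_div, inv_le_inv₀ (norm_pos_iff.2 hD0) (by positivity)]
  exact hDnorm.le

/-- **Holomorphy on the θ-strip** of `z ↦ D(z)⁻¹`. [folklore] -/
theorem differentiableOn_inv_bareDen_of_lt_one {om : ℝ} (hom : om ≠ 0) {θ : ℝ} (hθ1 : θ < 1) (μ t : ℝ) :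
    DifferentiableOn ℂ (fun z : ℂ => (-I * om + (-2 * (Complex.cos (2 * π * z) + (Real.cos (2 * π * t) : ℂ)) - μ))⁻¹)
      {z : ℂ | |z.im| < Real.arsinh (θ * |om| / 2) / (2 * π)} := by
  have hD : Differentiable ℂ (fun z : ℂ => -I * om + (-2 * (Complex.cos (2 * π * z) + (Real.cos (2 * π * t) : ℂ)) - μ)) := by
    fun_prop
  intro z hz
  exact ((hD z).inv (norm_inv_bareDen_le_of_lt_one hom hθ1 μ t hz).1).differentiableWithinAt

/-- **THE θ-SHARPENED DOOR** (`0 < Λ ≤ |ω|`, `0 < θ < 1`):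
`‖𝓕g_ω(n)‖ ≤ (1/((1−θ)|ω|))·exp(−arsinh(θ|ω|/2)·max(|n₀|, |n₁|))` — as `θ → 1` the rate approaches the pole-limited `arsinh(|ω|/2)`
(`e^{−‖n‖∞/64.0…}` at `|ω| = klE0 = 1/32`) at the price of the height `1/((1−θ)|ω|)`; `θ = 1/2` is `norm_mFourierCoeff_uvSpatialSymbol_le_exp`.
[cite: TrefethenWeideman2014, §4 Thm. 4.2]; [cite: BenfattoGiulianiMastropietro2006, §2.2 (2.9)] -/
theorem norm_mFourierCoeff_uvSpatialSymbol_le_exp_of_lt_one {Λ : ℝ} (hΛ : 0 < Λ) (μ : ℝ) {om : ℝ} (hom : Λ ≤ |om|)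
    {θ : ℝ} (hθ0 : 0 < θ) (hθ1 : θ < 1) (n : Fin 2 → ℤ) :
    ‖mFourierCoeff (Torus.descend (fun y : Momentum => uvSymbolFn 1 Λ (frameLevel μ 0 ((2 * π) • y)) om)
        (uvSpatialSymbol_isLatticePeriodic 1 Λ μ 0 om)) n‖ ≤
      1 / ((1 - θ) * |om|) * Real.exp (-(Real.arsinh (θ * |om| / 2) * max |(n 0 : ℝ)| |(n 1 : ℝ)|)) := by
  have hom0' : 0 < |om| := hΛ.trans_le hom
  have hom0 : om ≠ 0 := abs_pos.1 hom0'
  have h2π : (0 : ℝ) < 2 * π := Real.two_pi_pos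
  set a : ℝ := Real.arsinh (θ * |om| / 2) / (2 * π) with ha_def
  have ha : 0 < a := div_pos (Real.arsinh_pos_iff.2 (by positivity)) h2π
  set v : ℝ → ℂ → ℂ := fun t z => (-I * om + (-2 * (Complex.cos (2 * π * z) + (Real.cos (2 * π * t) : ℂ)) - μ))⁻¹ with hv
  have hd : ∀ t, DifferentiableOn ℂ (v t) {z : ℂ | |z.im| < a} := fun t => differentiableOn_inv_bareDen_of_lt_one hom0 hθ1 μ t
  have hper : ∀ t (z : ℂ), v t (z + 1) = v t z := fun t z => inv_bareDen_periodic om μ t z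
  have hM : ∀ t (z : ℂ), |z.im| < a → ‖v t z‖ ≤ 1 / ((1 - θ) * |om|) := fun t z hz =>
    (norm_inv_bareDen_le_of_lt_one hom0 hθ1 μ t hz).2
  have hv₀ : ∀ t s : ℝ, v t s = Torus.descend (fun y : Momentum => uvSymbolFn 1 Λ (frameLevel μ 0 ((2 * π) • y)) om)
      (uvSpatialSymbol_isLatticePeriodic 1 Λ μ 0 om) (fun i => (((![s, t] : Fin 2 → ℝ) i : ℝ) : UnitAddCircle)) :=
    fun t s => (descend_uvSpatialSymbol_apply_eq_inv hΛ hom μ s t).symm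
  have hv₁ : ∀ s t : ℝ, v s t = Torus.descend (fun y : Momentum => uvSymbolFn 1 Λ (frameLevel μ 0 ((2 * π) • y)) om)
      (uvSpatialSymbol_isLatticePeriodic 1 Λ μ 0 om) (fun i => (((![s, t] : Fin 2 → ℝ) i : ℝ) : UnitAddCircle)) := by
    intro s t
    rw [descend_uvSpatialSymbol_apply_eq_inv hΛ hom μ s t, hv]
    simp only
    rw [add_comm (Complex.cos (2 * π * (t : ℂ))), Complex.ofReal_cos, Complex.ofReal_cos]
    push_cast
    ring
  have key := Literature.Analysis.Complex.norm_mFourierCoeff_le_exp_of_strip_sup (measurable_descend_uvSpatialSymbol Λ μ hom0)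
    ha v v hd hper hM hv₀ hd hper hM hv₁ n
  have h2 : 2 * π * a = Real.arsinh (θ * |om| / 2) := by
    rw [ha_def]; field_simp
  rw [h2] at key
  exact key

end Summit.HubbardSuperconductivity.HubbardSuperconductivity.Theorems.KLRegimeSplit

end
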